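import Literature.Analysis.FluidPDE.AxisymOmegaEnergy
import Literature.Analysis.FluidPDE.RadialQuotientSobolev
import HarnessLib

/-!
# The gradient field `∇W` of an axisymmetric scalar: norms, axisymmetry, the radial derivative
# `D(∇W)[e_r]`, the Hessian–Laplacian identity in `L²`, and Lemma 2.1 (second estimate) in
# Tao-friendly form — `∫ ‖D(∇(vʳ/r))[e_r]‖² ≤ ∫ (∂_z(ω^θ/r))²`

Analysis/FluidPDE support file (all results proved; no definitions, no named facts) on the
discharge path of the named fact `Literature.Analysis.FluidPDE.LeiZhang2017_logModulus_regularity`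
(Lei–Zhang 2017, arXiv:1505.02628, Cor. 1.3). In §3 (arXiv p. 8) the Form Boundedness Condition
(FBC-2) is applied with `f = ∇(vʳ/r)`:
"`‖v^θ∇(vʳ/r)‖²_{L²} ≤ δ_*‖∂ᵣ∇(vʳ/r)‖²_{L²} + C₀∫_{r ≥ r₀}|∇(vʳ/r)|²`", followed by Lemma 2.1,
"`‖∂ᵣ∇(vʳ/r)‖ ≤ ‖∇²(vʳ/r)‖ ≤ K₀‖∂_zΩ‖`". This file supplies, for the vector field `F = ∇W`
(`W = radVelQuot u = vʳ/r`, Mathlib's `gradient`):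

* coordinates and norms: `gradient_apply_eq_fderiv_single`, `norm_gradient_sq`
  (`‖∇W‖² = Σᵢ(∂ᵢW)²`), `contDiff_gradient_of_succ`, `fderiv_gradient_apply_coord`,
  `norm_fderiv_gradient_apply_sq` (`‖D(∇W)[v]‖² = Σᵢ (D(∂ᵢW)[v])²`), and the pointwise bound
  `norm_fderiv_gradient_eR_sq_le` (`‖D(∇W)[e_r]‖² ≤ Σᵢⱼ(∂ⱼ∂ᵢW)²`, `|e_r| ≤ 1`);
* axisymmetry (hypotheses of the FBC lemmas of `LeiZhang2017FBC`):
  `isAxisymmetricScalar_norm_gradient_sq`, `isAxisymmetricScalar_norm_fderiv_gradient_eR_sq`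
  (the sums `Σᵢ ℓ(bᵢ)²` of a functional do not depend on the orthonormal basis,
  `frobeniusNormSq_eq_sum`; `e_r(R_θx) = R_θ e_r(x)`);
* **the Hessian–Laplacian identity in `L²` without compact support**:
  `integral_sq_fderiv_fderiv_eq_integral_mul` (`∫ (∂ⱼ∂ᵢW)² = ∫ ∂ᵢ∂ᵢW ∂ⱼ∂ⱼW`, two whole-space
  integrations by parts under `L²` hypotheses on `∂W, ∂²W, ∂³W`) and
  `integral_sum_sq_fderiv_fderiv_eq_integral_laplacian_sq_of_memLp` (`∫ Σᵢⱼ(∂ⱼ∂ᵢW)² = ∫ (ΔW)²`;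
  the tree's `integral_sum_sq_fderiv_fderiv_eq_integral_laplacian_sq` assumes compact support);
* `memLp_coord_mul_fderiv_radDerivQuot` — the weighted hypotheses `xᵢ ∂ᵢq_G ∈ L²` of
  `HouLeiLiEstimate`'s second estimate follow from `∂ᵢ∂ᵢG, q_G ∈ L²` (`xᵢ∂ᵢq = ∂ᵢ∂ᵢG − q`);
* **Lemma 2.1, second estimate, radial-gradient form**:
  `IsAxisymmetric.integral_norm_fderiv_gradient_radVelQuot_eR_sq_le` —
  `∫ ‖D(∇(vʳ/r))[e_r]‖² ≤ ∫ (∂_z(ω^θ/r))²` for an axisymmetric divergence-free `u ∈ C⁶` under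
  unweighted `L²` hypotheses (all valid in Tao's class, `AxisymQuotientRayAverage`).

## Mathlib / tree search

Tree: `integral_mul_fderiv_fderiv_eq_neg_sq`, `integral_mul_fderiv_eq_neg_of_differentiable`,
`fderiv_fderiv_apply_comm_vec_scalar`, `radDerivQuot_add_mul_fderiv_eq`,
`IsAxisymmetric.integral_laplacian_radVelQuot_sq_le` (`HouLeiLiEstimate`),
`memLp_radDerivQuot_of_memLp` (`RadialQuotientSobolev`), `IsAxisymmetricScalar.fderiv_rotZ_apply_rotZ`
(`AxisymRadialQuotient`), `frobeniusNormSq_eq_sum` (`VectorCalculus`), `rotZLIE`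
(`AxisymmetricVorticityTransport`). Mathlib: `gradient`, `InnerProductSpace.toDual_symm_apply`,
`fderiv_clm_apply`, `OrthonormalBasis.map`. `lean search 'norm_fderiv_gradient|integral_sum_sq_fderiv_fderiv_eq_integral_laplacian_sq_of'`: nothing before this file.

## References

* Z. Lei, Q. S. Zhang, Pacific J. Math. 289 (2017) 169–187, arXiv:1505.02628, Lemma 2.1 (second
  estimate) and §3, p. 8 (use of (FBC-2) with `f = ∇(vʳ/r)`). [`LeiZhang2017`]
* E. M. Stein, *Singular Integrals*, Ch. III §1.3 (`‖∂ⱼ∂ₖf‖₂ ≤ ‖Δf‖₂`). [folklore]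
-/

noncomputable section

open MeasureTheory Set Function Filter Topology InnerProductSpace WithLp
open scoped RealInnerProductSpace Laplacian ContDiff ENNReal

namespace Literature.Analysis.FluidPDE

/-! ### The weighted hypotheses of Lemma 2.1 from unweighted ones -/

section Weighted

variable {G : EuclideanSpace ℝ (Fin 3) → ℝ}

/-- **`xᵢ ∂ᵢq_G = ∂ᵢ∂ᵢG − q_G ∈ L²`** (`i = 0, 1`) as soon as `∂ᵢ∂ᵢG, q_G ∈ L²`, for an
axisymmetric scalar `G ∈ C³` (`radDerivQuot_add_mul_fderiv_eq`). [folklore] -/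
theorem memLp_coord_mul_fderiv_radDerivQuot (hG : ContDiff ℝ 3 G) (hax : IsAxisymmetricScalar G)
    {i : Fin 3} (hi : i = 0 ∨ i = 1) (hq : MemLp (radDerivQuot G) 2 volume)
    (hGii : MemLp (fun x => fderiv ℝ (fun y => fderiv ℝ G y (EuclideanSpace.single i 1)) x
      (EuclideanSpace.single i 1)) 2 volume) :
    MemLp (fun x => x i * fderiv ℝ (radDerivQuot G) x (EuclideanSpace.single i 1)) 2 volume := by
  refine (hGii.sub hq).ae_eq (Eventually.of_forall fun x => ?_)
  have h := radDerivQuot_add_mul_fderiv_eq hG hax hi x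
  simp only [Pi.sub_apply]
  linarith

variable {u : EuclideanSpace ℝ (Fin 3) → EuclideanSpace ℝ (Fin 3)}

/-- **Lemma 2.1, second estimate (Laplacian form), unweighted hypotheses**:
`∫ (Δ(uʳ/r))² ≤ ∫ (∂_z(ω^θ/r))²` for an axisymmetric divergence-free `u ∈ C⁵` with
`q_W, ∂ᵢW, ∂ᵢ∂ᵢW ∈ L²` (`W = uʳ/r`) and `q_{∂₂W} ∈ L²` — the tree's
`IsAxisymmetric.integral_laplacian_radVelQuot_sq_le` with its hypotheses `xᵢ∂ᵢq_W ∈ L²` derived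
from `memLp_coord_mul_fderiv_radDerivQuot`. [cite: LeiZhang2017, Lemma 2.1 (second estimate)] -/
theorem IsAxisymmetric.integral_laplacian_radVelQuot_sq_le' (hax : IsAxisymmetric u)
    (hu : ContDiff ℝ 5 u) (hdiv : VectorCalculus.IsDivFree u)
    (hq : MemLp (radDerivQuot (radVelQuot u)) 2 volume)
    (hG : ∀ i : Fin 3, MemLp (fun x => fderiv ℝ (radVelQuot u) x (EuclideanSpace.single i 1)) 2 volume)
    (hGG : ∀ i : Fin 3, MemLp (fun x => fderiv ℝ (fun y => fderiv ℝ (radVelQuot u) y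
      (EuclideanSpace.single i 1)) x (EuclideanSpace.single i 1)) 2 volume)
    (hqH : MemLp (radDerivQuot fun y => fderiv ℝ (radVelQuot u) y (EuclideanSpace.single 2 1)) 2
      volume) :
    ∫ x, (Δ (radVelQuot u)) x ^ 2 ≤
      ∫ x, fderiv ℝ (angVortQuot u) x (EuclideanSpace.single 2 1) ^ 2 := by
  have hW3 : ContDiff ℝ 3 (radVelQuot u) := contDiff_radVelQuot (n := 3) (by exact_mod_cast hu)
  have hWax : IsAxisymmetricScalar (radVelQuot u) :=
    hax.isAxisymmetricScalar_radVelQuot (hu.of_le (by norm_num))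
  have hx0 := memLp_coord_mul_fderiv_radDerivQuot hW3 hWax (Or.inl rfl) hq (hGG 0)
  have hx1 := memLp_coord_mul_fderiv_radDerivQuot hW3 hWax (Or.inr rfl) hq (hGG 1)
  exact hax.integral_laplacian_radVelQuot_sq_le hu hdiv hq (hG 0) (hG 1) (hG 2) (hGG 0) (hGG 1)
    (hGG 2) hx0 hx1 hqH

end Weighted

/-! ### The Hessian–Laplacian identity in `L²` -/

section HessLap

variable {W : EuclideanSpace ℝ (Fin 3) → ℝ}

/-- Symmetry of third partials: `∂_b∂_b∂_aW = ∂_a∂_b∂_bW` for `W ∈ C³`. [folklore] -/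
theorem fderiv_fderiv_fderiv_comm (hW : ContDiff ℝ 3 W) (x a b : EuclideanSpace ℝ (Fin 3)) :
    fderiv ℝ (fun y => fderiv ℝ (fun z => fderiv ℝ W z a) y b) x b =
      fderiv ℝ (fun y => fderiv ℝ (fun z => fderiv ℝ W z b) y b) x a := by
  have hW2 : ContDiff ℝ 2 W := hW.of_le (by norm_num)
  have h1 : (fun y => fderiv ℝ (fun z => fderiv ℝ W z a) y b) =
      fun y => fderiv ℝ (fun z => fderiv ℝ W z b) y a :=
    funext fun y => fderiv_fderiv_apply_comm_vec_scalar hW2 y a b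
  rw [h1]
  have hG : ContDiff ℝ 2 (fun z => fderiv ℝ W z b) :=
    contDiff_fderiv_apply_const_succ (n := 2) (by exact_mod_cast hW) b
  exact fderiv_fderiv_apply_comm_vec_scalar hG x a b

/-- **`∫ (∂ⱼ∂ᵢW)² = ∫ ∂ᵢ∂ᵢW · ∂ⱼ∂ⱼW`** on `ℝ³` for `W ∈ C³` with `∂ᵢW, ∂ⱼ∂ᵢW, ∂ᵢ∂ᵢW, ∂ⱼ∂ⱼW,
∂ⱼ∂ⱼ∂ᵢW ∈ L²` (integrate by parts twice: `∫ (∂ⱼ∂ᵢW)² = −∫ ∂ᵢW ∂ⱼ∂ⱼ∂ᵢW = −∫ ∂ᵢW ∂ᵢ(∂ⱼ∂ⱼW)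
= ∫ ∂ᵢ∂ᵢW ∂ⱼ∂ⱼW`). [folklore] -/
theorem integral_sq_fderiv_fderiv_eq_integral_mul (hW : ContDiff ℝ 3 W) (i j : Fin 3)
    (h1 : MemLp (fun x => fderiv ℝ W x (EuclideanSpace.single i 1)) 2 volume)
    (h2ij : MemLp (fun x => fderiv ℝ (fun y => fderiv ℝ W y (EuclideanSpace.single i 1)) x
      (EuclideanSpace.single j 1)) 2 volume)
    (h2ii : MemLp (fun x => fderiv ℝ (fun y => fderiv ℝ W y (EuclideanSpace.single i 1)) x
      (EuclideanSpace.single i 1)) 2 volume)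
    (h2jj : MemLp (fun x => fderiv ℝ (fun y => fderiv ℝ W y (EuclideanSpace.single j 1)) x
      (EuclideanSpace.single j 1)) 2 volume)
    (h3 : MemLp (fun x => fderiv ℝ (fun y => fderiv ℝ (fun z => fderiv ℝ W z
      (EuclideanSpace.single i 1)) y (EuclideanSpace.single j 1)) x (EuclideanSpace.single j 1))
      2 volume) :
    ∫ x, (fderiv ℝ (fun y => fderiv ℝ W y (EuclideanSpace.single i 1)) x
        (EuclideanSpace.single j 1)) ^ 2 =
      ∫ x, fderiv ℝ (fun y => fderiv ℝ W y (EuclideanSpace.single i 1)) x (EuclideanSpace.single i 1) *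
        fderiv ℝ (fun y => fderiv ℝ W y (EuclideanSpace.single j 1)) x (EuclideanSpace.single j 1) := by
  set ei : EuclideanSpace ℝ (Fin 3) := EuclideanSpace.single i 1 with hei
  set ej : EuclideanSpace ℝ (Fin 3) := EuclideanSpace.single j 1 with hej
  set Wi : EuclideanSpace ℝ (Fin 3) → ℝ := fun y => fderiv ℝ W y ei with hWi
  set Wjj : EuclideanSpace ℝ (Fin 3) → ℝ := fun y => fderiv ℝ (fun z => fderiv ℝ W z ej) y ej
    with hWjj
  have hWi2 : ContDiff ℝ 2 Wi := contDiff_fderiv_apply_const_succ (n := 2) (by exact_mod_cast hW) ei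
  have hWid : Differentiable ℝ Wi := hWi2.differentiable two_ne_zero
  have hWj2 : ContDiff ℝ 2 fun z => fderiv ℝ W z ej :=
    contDiff_fderiv_apply_const_succ (n := 2) (by exact_mod_cast hW) ej
  have hWjj1 : ContDiff ℝ 1 Wjj := contDiff_fderiv_apply_const_succ (n := 1) (by exact_mod_cast hWj2) ej
  have hWjjd : Differentiable ℝ Wjj := hWjj1.differentiable one_ne_zero
  -- (A) `∫ Wi ∂ⱼ∂ⱼWi = −∫ (∂ⱼWi)²`
  have hA := integral_mul_fderiv_fderiv_eq_neg_sq hWi2 ej h1 h2ij h3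
  -- (C) `∂ⱼ∂ⱼWi = ∂ᵢWjj`
  have hcomm : ∀ x, fderiv ℝ (fun y => fderiv ℝ Wi y ej) x ej = fderiv ℝ Wjj x ei := fun x =>
    fderiv_fderiv_fderiv_comm hW x ei ej
  have h3' : MemLp (fun x => fderiv ℝ Wjj x ei) 2 volume :=
    h3.ae_eq (Eventually.of_forall fun x => hcomm x)
  -- (B) `∫ Wjj ∂ᵢWi = −∫ ∂ᵢWjj Wi`
  have hB := integral_mul_fderiv_eq_neg_of_differentiable hWjjd hWid ei
    (h3'.integrable_mul h1) (h2jj.integrable_mul h2ii) (h2jj.integrable_mul h1)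
  -- assemble
  have e1 : ∫ x, (fderiv ℝ Wi x ej) ^ 2 = -∫ x, Wi x * fderiv ℝ (fun y => fderiv ℝ Wi y ej) x ej := by
    rw [hA]; ring
  have e2 : ∫ x, Wi x * fderiv ℝ (fun y => fderiv ℝ Wi y ej) x ej = ∫ x, fderiv ℝ Wjj x ei * Wi x :=
    integral_congr_ae (Eventually.of_forall fun x => by beta_reduce; rw [hcomm x, mul_comm])
  rw [e1, e2, ← hB]
  exact integral_congr_ae (Eventually.of_forall fun x => by simp only [hWjj, hWi]; ring)

/-- **`∫ Σᵢⱼ (∂ⱼ∂ᵢW)² = ∫ (ΔW)²`** on `ℝ³` (the `L²` identity `‖∇²W‖ = ‖ΔW‖`) for `W ∈ C³` with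
`∂ᵢW, ∂ⱼ∂ᵢW, ∂ⱼ∂ⱼ∂ᵢW ∈ L²` (no compact support; cf. the tree's
`integral_sum_sq_fderiv_fderiv_eq_integral_laplacian_sq`). [folklore] -/
theorem integral_sum_sq_fderiv_fderiv_eq_integral_laplacian_sq_of_memLp (hW : ContDiff ℝ 3 W)
    (h1 : ∀ i : Fin 3, MemLp (fun x => fderiv ℝ W x (EuclideanSpace.single i 1)) 2 volume)
    (h2 : ∀ i j : Fin 3, MemLp (fun x => fderiv ℝ (fun y => fderiv ℝ W y (EuclideanSpace.single i 1)) x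
      (EuclideanSpace.single j 1)) 2 volume)
    (h3 : ∀ i j : Fin 3, MemLp (fun x => fderiv ℝ (fun y => fderiv ℝ (fun z => fderiv ℝ W z
      (EuclideanSpace.single i 1)) y (EuclideanSpace.single j 1)) x (EuclideanSpace.single j 1))
      2 volume) :
    ∫ x, ∑ i, ∑ j, (fderiv ℝ (fun y => fderiv ℝ W y (EuclideanSpace.single i 1)) x
        (EuclideanSpace.single j 1)) ^ 2 = ∫ x, ((Δ W) x) ^ 2 := by
  have hW2 : ContDiff ℝ 2 W := hW.of_le (by norm_num)
  set H : Fin 3 → Fin 3 → EuclideanSpace ℝ (Fin 3) → ℝ := fun i j x =>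
    fderiv ℝ (fun y => fderiv ℝ W y (EuclideanSpace.single i 1)) x (EuclideanSpace.single j 1) with hH
  have hpair : ∀ i j, ∫ x, (H i j x) ^ 2 = ∫ x, H i i x * H j j x := fun i j =>
    integral_sq_fderiv_fderiv_eq_integral_mul hW i j (h1 i) (h2 i j) (h2 i i) (h2 j j) (h3 i j)
  have hIsq : ∀ i j, Integrable (fun x => (H i j x) ^ 2) volume := fun i j => (h2 i j).integrable_sq
  have hIpr : ∀ i j, Integrable (fun x => H i i x * H j j x) volume := fun i j =>
    (h2 i i).integrable_mul (h2 j j)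
  -- Laplacian in coordinates
  have hLap : ∀ x, (Δ W) x = ∑ i, H i i x := fun x => by
    rw [laplacian_eq_sum_fderiv_fderiv (EuclideanSpace.basisFun (Fin 3) ℝ) hW2 x]
    simp only [EuclideanSpace.basisFun_apply, hH]
  have s1 : ∫ x, ∑ i, ∑ j, (H i j x) ^ 2 = ∑ i, ∫ x, ∑ j, (H i j x) ^ 2 :=
    integral_finsetSum _ fun i _ => integrable_finsetSum _ fun j _ => hIsq i j
  have s2 : ∑ i, ∫ x, ∑ j, (H i j x) ^ 2 = ∑ i, ∑ j, ∫ x, (H i j x) ^ 2 :=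
    Finset.sum_congr rfl fun i _ => integral_finsetSum _ fun j _ => hIsq i j
  have s3 : ∑ i, ∑ j, ∫ x, (H i j x) ^ 2 = ∑ i, ∑ j, ∫ x, H i i x * H j j x :=
    Finset.sum_congr rfl fun i _ => Finset.sum_congr rfl fun j _ => hpair i j
  have s4 : ∑ i, ∑ j, ∫ x, H i i x * H j j x = ∑ i, ∫ x, ∑ j, H i i x * H j j x :=
    Finset.sum_congr rfl fun i _ => (integral_finsetSum _ fun j _ => hIpr i j).symm
  have s5 : ∑ i, ∫ x, ∑ j, H i i x * H j j x = ∫ x, ∑ i, ∑ j, H i i x * H j j x :=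
    (integral_finsetSum _ fun i _ => integrable_finsetSum _ fun j _ => hIpr i j).symm
  have s6 : ∫ x, ∑ i, ∑ j, H i i x * H j j x = ∫ x, ((Δ W) x) ^ 2 := by
    refine integral_congr_ae (Eventually.of_forall fun x => ?_)
    beta_reduce
    rw [hLap x, sq, Finset.sum_mul_sum]
  have key : ∫ x, ∑ i, ∑ j, (H i j x) ^ 2 = ∫ x, ((Δ W) x) ^ 2 := by
    rw [s1, s2, s3, s4, s5, s6]
  exact key

end HessLap

/-! ### The gradient field: coordinates, norms, derivative -/

section Grad

variable {W : EuclideanSpace ℝ (Fin 3) → ℝ}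

/-- `‖y‖² = y₀² + y₁² + y₂²` on `ℝ³`. [folklore] -/
private theorem norm_sq_eq_sum_three (y : EuclideanSpace ℝ (Fin 3)) : ‖y‖ ^ 2 = y 0 ^ 2 + y 1 ^ 2 + y 2 ^ 2 := by
  rw [EuclideanSpace.norm_eq, Real.sq_sqrt (by positivity), Fin.sum_univ_three]
  simp only [Real.norm_eq_abs, sq_abs]

/-- Coordinates of the gradient: `(∇W)ᵢ = ∂ᵢW`. [folklore] -/
theorem gradient_apply_eq_fderiv_single (W : EuclideanSpace ℝ (Fin 3) → ℝ) (x : EuclideanSpace ℝ (Fin 3))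
    (i : Fin 3) : gradient W x i = fderiv ℝ W x (EuclideanSpace.single i 1) := by
  have h1 : gradient W x i = ⟪gradient W x, EuclideanSpace.single i (1 : ℝ)⟫ := by
    rw [EuclideanSpace.inner_single_right]; simp
  rw [h1, gradient, InnerProductSpace.toDual_symm_apply]

/-- **`‖∇W‖² = (∂₀W)² + (∂₁W)² + (∂₂W)²`**. [folklore] -/
theorem norm_gradient_sq (W : EuclideanSpace ℝ (Fin 3) → ℝ) (x : EuclideanSpace ℝ (Fin 3)) :
    ‖gradient W x‖ ^ 2 = fderiv ℝ W x (EuclideanSpace.single 0 1) ^ 2 +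
      fderiv ℝ W x (EuclideanSpace.single 1 1) ^ 2 + fderiv ℝ W x (EuclideanSpace.single 2 1) ^ 2 := by
  rw [norm_sq_eq_sum_three, gradient_apply_eq_fderiv_single, gradient_apply_eq_fderiv_single,
    gradient_apply_eq_fderiv_single]

/-- `‖∇W(x)‖ = ‖DW(x)‖` (Riesz). [folklore] -/
private theorem norm_gradient_eq_opNorm_fderiv (W : EuclideanSpace ℝ (Fin 3) → ℝ) (x : EuclideanSpace ℝ (Fin 3)) :
    ‖gradient W x‖ = ‖fderiv ℝ W x‖ := by
  rw [gradient]
  exact (InnerProductSpace.toDual ℝ (EuclideanSpace ℝ (Fin 3))).symm.norm_map _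

/-- Parseval for functionals on `ℝ³`: `Σᵢ ℓ(bᵢ)² = Σᵢ ℓ(eᵢ)²` for every orthonormal basis `b`.
[folklore] -/
theorem sum_sq_apply_orthonormalBasis (ℓ : EuclideanSpace ℝ (Fin 3) →L[ℝ] ℝ)
    (b : OrthonormalBasis (Fin 3) ℝ (EuclideanSpace ℝ (Fin 3))) :
    ∑ i, (ℓ (b i)) ^ 2 = ∑ i, (ℓ (EuclideanSpace.single i 1)) ^ 2 := by
  have h1 : ∑ i, (ℓ (b i)) ^ 2 = FluidPDE.frobeniusNormSq ℓ := by
    rw [FluidPDE.frobeniusNormSq_eq_sum b]; simp [Real.norm_eq_abs, sq_abs]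
  have h2 : ∑ i, (ℓ (EuclideanSpace.single i 1)) ^ 2 = FluidPDE.frobeniusNormSq ℓ := by
    rw [FluidPDE.frobeniusNormSq_eq_sum (EuclideanSpace.basisFun (Fin 3) ℝ)]
    simp [Real.norm_eq_abs, sq_abs]
  rw [h1, h2]

/-- `W ∈ Cⁿ⁺¹ ⇒ ∇W ∈ Cⁿ`. [folklore] -/
theorem contDiff_gradient_of_succ {n : ℕ∞} (hW : ContDiff ℝ ((n : WithTop ℕ∞) + 1) W) :
    ContDiff ℝ n (gradient W) :=
  (InnerProductSpace.toDual ℝ (EuclideanSpace ℝ (Fin 3))).symm.contDiff.comp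
    (hW.fderiv_right (m := n) le_rfl)

/-- `D(y ↦ DW(y) c)(x) v = D²W(x)[v][c]`. [folklore] -/
theorem fderiv_fderiv_apply_eq_fderiv_fderiv (hW : ContDiff ℝ 2 W) (x v c : EuclideanSpace ℝ (Fin 3)) :
    fderiv ℝ (fun y => fderiv ℝ W y c) x v = fderiv ℝ (fderiv ℝ W) x v c := by
  have hd : DifferentiableAt ℝ (fderiv ℝ W) x :=
    ((hW.fderiv_right (m := 1) (by norm_num)).differentiable one_ne_zero) x
  rw [fderiv_clm_apply hd (differentiableAt_const c)]
  simp only [fderiv_fun_const, Pi.zero_apply, ContinuousLinearMap.comp_zero, zero_add,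
    ContinuousLinearMap.flip_apply]

/-- **Coordinates of `D(∇W)`**: `(D(∇W)(x) v)ᵢ = D(∂ᵢW)(x) v`. [folklore] -/
theorem fderiv_gradient_apply_coord (hW : ContDiff ℝ 2 W) (x v : EuclideanSpace ℝ (Fin 3)) (i : Fin 3) :
    fderiv ℝ (gradient W) x v i =
      fderiv ℝ (fun y => fderiv ℝ W y (EuclideanSpace.single i 1)) x v := by
  have hd : DifferentiableAt ℝ (fderiv ℝ W) x :=
    ((hW.fderiv_right (m := 1) (by norm_num)).differentiable one_ne_zero) x
  have h : HasFDerivAt (gradient W)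
      (((InnerProductSpace.toDual ℝ (EuclideanSpace ℝ (Fin 3))).symm.toContinuousLinearEquiv :
        (EuclideanSpace ℝ (Fin 3) →L[ℝ] ℝ) →L[ℝ] EuclideanSpace ℝ (Fin 3)).comp
        (fderiv ℝ (fderiv ℝ W) x)) x :=
    (InnerProductSpace.toDual ℝ (EuclideanSpace ℝ (Fin 3))).symm.toContinuousLinearEquiv.hasFDerivAt.comp
      x hd.hasFDerivAt
  rw [h.fderiv]
  have h2 : ((InnerProductSpace.toDual ℝ (EuclideanSpace ℝ (Fin 3))).symm.toContinuousLinearEquiv :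
      (EuclideanSpace ℝ (Fin 3) →L[ℝ] ℝ) →L[ℝ] EuclideanSpace ℝ (Fin 3)).comp
        (fderiv ℝ (fderiv ℝ W) x) v =
      (InnerProductSpace.toDual ℝ (EuclideanSpace ℝ (Fin 3))).symm (fderiv ℝ (fderiv ℝ W) x v) := rfl
  rw [h2]
  have h3 : (InnerProductSpace.toDual ℝ (EuclideanSpace ℝ (Fin 3))).symm (fderiv ℝ (fderiv ℝ W) x v) i =
      ⟪(InnerProductSpace.toDual ℝ (EuclideanSpace ℝ (Fin 3))).symm (fderiv ℝ (fderiv ℝ W) x v),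
        EuclideanSpace.single i (1 : ℝ)⟫ := by
    rw [EuclideanSpace.inner_single_right]; simp
  rw [h3, InnerProductSpace.toDual_symm_apply, fderiv_fderiv_apply_eq_fderiv_fderiv hW]

/-- **`‖D(∇W)(x) v‖² = Σᵢ (D(∂ᵢW)(x) v)²`**. [folklore] -/
theorem norm_fderiv_gradient_apply_sq (hW : ContDiff ℝ 2 W) (x v : EuclideanSpace ℝ (Fin 3)) :
    ‖fderiv ℝ (gradient W) x v‖ ^ 2 =
      fderiv ℝ (fun y => fderiv ℝ W y (EuclideanSpace.single 0 1)) x v ^ 2 +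
      fderiv ℝ (fun y => fderiv ℝ W y (EuclideanSpace.single 1 1)) x v ^ 2 +
      fderiv ℝ (fun y => fderiv ℝ W y (EuclideanSpace.single 2 1)) x v ^ 2 := by
  rw [norm_sq_eq_sum_three, fderiv_gradient_apply_coord hW, fderiv_gradient_apply_coord hW,
    fderiv_gradient_apply_coord hW]

/-- Cauchy–Schwarz in coordinates: `(DG(x) v)² ≤ ‖v‖² Σᵢ(∂ᵢG(x))²`. [folklore] -/
theorem sq_fderiv_apply_le (G : EuclideanSpace ℝ (Fin 3) → ℝ) (x v : EuclideanSpace ℝ (Fin 3)) :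
    (fderiv ℝ G x v) ^ 2 ≤ ‖v‖ ^ 2 * (fderiv ℝ G x (EuclideanSpace.single 0 1) ^ 2 +
      fderiv ℝ G x (EuclideanSpace.single 1 1) ^ 2 + fderiv ℝ G x (EuclideanSpace.single 2 1) ^ 2) := by
  rw [fderiv_apply_eq_sum_three G x v, norm_sq_eq_sum_three]
  nlinarith [sq_nonneg (v 0 * fderiv ℝ G x (EuclideanSpace.single 1 1) -
      v 1 * fderiv ℝ G x (EuclideanSpace.single 0 1)),
    sq_nonneg (v 0 * fderiv ℝ G x (EuclideanSpace.single 2 1) -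
      v 2 * fderiv ℝ G x (EuclideanSpace.single 0 1)),
    sq_nonneg (v 1 * fderiv ℝ G x (EuclideanSpace.single 2 1) -
      v 2 * fderiv ℝ G x (EuclideanSpace.single 1 1))]

/-- The horizontal vector `(x₀, x₁, 0)` has norm `r`. [folklore] -/
private theorem norm_toLp_horizontal (x : EuclideanSpace ℝ (Fin 3)) :
    ‖(toLp 2 ![x 0, x 1, 0] : EuclideanSpace ℝ (Fin 3))‖ = cylRadius x := by
  rw [cylRadius, EuclideanSpace.norm_eq, Fin.sum_univ_three]
  simp [Real.norm_eq_abs, sq_abs]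

/-- `‖e_r‖ ≤ 1` (`1` off the axis, `0` on it). [folklore] -/
private theorem norm_eR_le_one' (x : EuclideanSpace ℝ (Fin 3)) : ‖eR x‖ ≤ 1 := by
  rw [eR, norm_smul, norm_toLp_horizontal, Real.norm_eq_abs, abs_inv,
    abs_of_nonneg (cylRadius_nonneg x)]
  by_cases h : cylRadius x = 0
  · rw [h]; simp
  · rw [inv_mul_cancel₀ h]

/-- **`(DG[e_r])² ≤ Σᵢ (∂ᵢG)²`** pointwise for a scalar `G` (`|e_r| ≤ 1`, Cauchy–Schwarz); in
particular `(∂ᵣG)² ≤ |∇G|²`. [folklore] -/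
theorem sq_fderiv_apply_eR_le (G : EuclideanSpace ℝ (Fin 3) → ℝ) (x : EuclideanSpace ℝ (Fin 3)) :
    (fderiv ℝ G x (eR x)) ^ 2 ≤ fderiv ℝ G x (EuclideanSpace.single 0 1) ^ 2 +
      fderiv ℝ G x (EuclideanSpace.single 1 1) ^ 2 + fderiv ℝ G x (EuclideanSpace.single 2 1) ^ 2 := by
  have h := sq_fderiv_apply_le G x (eR x)
  have hv : ‖eR x‖ ^ 2 ≤ 1 := by
    have := norm_eR_le_one' x
    nlinarith [norm_nonneg (eR x)]
  have hnn : 0 ≤ fderiv ℝ G x (EuclideanSpace.single 0 1) ^ 2 +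
      fderiv ℝ G x (EuclideanSpace.single 1 1) ^ 2 + fderiv ℝ G x (EuclideanSpace.single 2 1) ^ 2 := by
    positivity
  nlinarith

/-- **`‖D(∇W)[e_r]‖² ≤ Σᵢⱼ (∂ⱼ∂ᵢW)²`** pointwise (`|e_r| ≤ 1`, Cauchy–Schwarz). [folklore] -/
theorem norm_fderiv_gradient_eR_sq_le (hW : ContDiff ℝ 2 W) (x : EuclideanSpace ℝ (Fin 3)) :
    ‖fderiv ℝ (gradient W) x (eR x)‖ ^ 2 ≤
      ∑ i, ∑ j, (fderiv ℝ (fun y => fderiv ℝ W y (EuclideanSpace.single i 1)) x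
        (EuclideanSpace.single j 1)) ^ 2 := by
  rw [norm_fderiv_gradient_apply_sq hW]
  have hv : ‖eR x‖ ^ 2 ≤ 1 := by
    have := norm_eR_le_one' x
    nlinarith [norm_nonneg (eR x)]
  have key : ∀ i : Fin 3, fderiv ℝ (fun y => fderiv ℝ W y (EuclideanSpace.single i 1)) x (eR x) ^ 2 ≤
      ∑ j, (fderiv ℝ (fun y => fderiv ℝ W y (EuclideanSpace.single i 1)) x
        (EuclideanSpace.single j 1)) ^ 2 := by
    intro i
    have h := sq_fderiv_apply_le (fun y => fderiv ℝ W y (EuclideanSpace.single i 1)) x (eR x)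
    rw [Fin.sum_univ_three]
    have hnn : 0 ≤ fderiv ℝ (fun y => fderiv ℝ W y (EuclideanSpace.single i 1)) x
        (EuclideanSpace.single 0 1) ^ 2 +
        fderiv ℝ (fun y => fderiv ℝ W y (EuclideanSpace.single i 1)) x (EuclideanSpace.single 1 1) ^ 2 +
        fderiv ℝ (fun y => fderiv ℝ W y (EuclideanSpace.single i 1)) x (EuclideanSpace.single 2 1) ^ 2 := by
      positivity
    nlinarith
  rw [Fin.sum_univ_three]
  linarith [key 0, key 1, key 2]

end Grad

/-! ### Axisymmetry of `‖∇W‖²` and `‖D(∇W)[e_r]‖²` -/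

section Symmetry

variable {W : EuclideanSpace ℝ (Fin 3) → ℝ}

/-- `R_θ (R_{−θ} v) = v`. [folklore] -/
theorem rotZ_apply_rotZ_neg (θ : ℝ) (v : EuclideanSpace ℝ (Fin 3)) : rotZ θ (rotZ (-θ) v) = v := by
  have h := rotZ_neg_apply_rotZ (-θ) v
  rwa [neg_neg] at h

/-- `e_r (R_θ x) = R_θ e_r (x)` (private restatement of the tree's `eR_rotZ`). [folklore] -/
private theorem eR_rotZ' (θ : ℝ) (x : EuclideanSpace ℝ (Fin 3)) : eR (rotZ θ x) = rotZ θ (eR x) := by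
  rw [eR, eR, cylRadius_rotZ]
  ext i
  fin_cases i <;> simp [rotZ] <;> ring

/-- For an axisymmetric scalar, `DW(R_θx)[v] = DW(x)[R_{−θ}v]`. [folklore] -/
theorem IsAxisymmetricScalar.fderiv_rotZ_apply (hax : IsAxisymmetricScalar W) (hd : Differentiable ℝ W)
    (θ : ℝ) (x v : EuclideanSpace ℝ (Fin 3)) :
    fderiv ℝ W (rotZ θ x) v = fderiv ℝ W x (rotZ (-θ) v) := by
  have h := hax.fderiv_rotZ_apply_rotZ hd θ x (rotZ (-θ) v)
  rwa [rotZ_apply_rotZ_neg] at h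

/-- **`‖∇W‖²` is axisymmetric** for an axisymmetric scalar `W` (the sums `Σᵢ DW(x)[bᵢ]²` do not
depend on the orthonormal basis `b`). [folklore] -/
theorem isAxisymmetricScalar_norm_gradient_sq (hax : IsAxisymmetricScalar W) (hd : Differentiable ℝ W) :
    IsAxisymmetricScalar fun x => ‖gradient W x‖ ^ 2 := by
  intro θ x
  simp only
  rw [norm_gradient_sq, norm_gradient_sq]
  have h := sum_sq_apply_orthonormalBasis (fderiv ℝ W x)
    ((EuclideanSpace.basisFun (Fin 3) ℝ).map (rotZLIE (-θ)))
  simp only [OrthonormalBasis.map_apply, EuclideanSpace.basisFun_apply, rotZLIE_apply,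
    Fin.sum_univ_three] at h
  rw [hax.fderiv_rotZ_apply hd, hax.fderiv_rotZ_apply hd, hax.fderiv_rotZ_apply hd]
  exact h

/-- Second derivatives of an axisymmetric scalar along rotated directions:
`D²W(R_θx)[R_θv][R_θw] = D²W(x)[v][w]`. [folklore] -/
theorem IsAxisymmetricScalar.fderiv_fderiv_rotZ (hax : IsAxisymmetricScalar W) (hW : ContDiff ℝ 2 W)
    (θ : ℝ) (x v w : EuclideanSpace ℝ (Fin 3)) :
    fderiv ℝ (fun y => fderiv ℝ W y (rotZ θ w)) (rotZ θ x) (rotZ θ v) =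
      fderiv ℝ (fun y => fderiv ℝ W y w) x v := by
  have hd : Differentiable ℝ W := hW.differentiable two_ne_zero
  set g' : EuclideanSpace ℝ (Fin 3) → ℝ := fun y => fderiv ℝ W y (rotZ θ w) with hg'
  have hg'c : ContDiff ℝ 1 g' := contDiff_fderiv_apply_const_succ (n := 1) (by exact_mod_cast hW) _
  have hg'd : Differentiable ℝ g' := hg'c.differentiable one_ne_zero
  -- `g' ∘ R_θ = (y ↦ DW(y)[w])`
  have hcomp : (fun y => g' (rotZL θ y)) = fun y => fderiv ℝ W y w := by
    funext y
    simp only [hg', rotZL_apply]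
    exact hax.fderiv_rotZ_apply_rotZ hd θ y w
  have hchain : HasFDerivAt (fun y => g' (rotZL θ y)) ((fderiv ℝ g' (rotZL θ x)).comp (rotZL θ)) x :=
    (hg'd (rotZL θ x)).hasFDerivAt.comp x (rotZL θ).hasFDerivAt
  rw [hcomp] at hchain
  rw [hchain.fderiv]
  simp only [ContinuousLinearMap.comp_apply, rotZL_apply]

/-- **`‖D(∇W)[e_r]‖²` is axisymmetric** for an axisymmetric scalar `W ∈ C²`
(`e_r(R_θx) = R_θe_r(x)`, `D²W(R_θx)[R_θv][R_θw] = D²W(x)[v][w]`, Parseval). [folklore] -/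
theorem isAxisymmetricScalar_norm_fderiv_gradient_eR_sq (hax : IsAxisymmetricScalar W)
    (hW : ContDiff ℝ 2 W) : IsAxisymmetricScalar fun x => ‖fderiv ℝ (gradient W) x (eR x)‖ ^ 2 := by
  intro θ x
  simp only
  rw [norm_fderiv_gradient_apply_sq hW, norm_fderiv_gradient_apply_sq hW, eR_rotZ']
  -- each term: `D(∂_{eᵢ}W)(R x)[R e_r] = D(∂_{R⁻¹eᵢ}W)(x)[e_r] = D²W(x)[e_r][R⁻¹eᵢ]`
  have key : ∀ c : EuclideanSpace ℝ (Fin 3),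
      fderiv ℝ (fun y => fderiv ℝ W y c) (rotZ θ x) (rotZ θ (eR x)) =
        fderiv ℝ (fderiv ℝ W) x (eR x) (rotZ (-θ) c) := by
    intro c
    have h := hax.fderiv_fderiv_rotZ hW θ x (eR x) (rotZ (-θ) c)
    rw [rotZ_apply_rotZ_neg] at h
    rw [h, fderiv_fderiv_apply_eq_fderiv_fderiv hW]
  rw [key, key, key]
  have h := sum_sq_apply_orthonormalBasis (fderiv ℝ (fderiv ℝ W) x (eR x))
    ((EuclideanSpace.basisFun (Fin 3) ℝ).map (rotZLIE (-θ)))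
  simp only [OrthonormalBasis.map_apply, EuclideanSpace.basisFun_apply, rotZLIE_apply,
    Fin.sum_univ_three] at h
  rw [h, fderiv_fderiv_apply_eq_fderiv_fderiv hW, fderiv_fderiv_apply_eq_fderiv_fderiv hW,
    fderiv_fderiv_apply_eq_fderiv_fderiv hW]

end Symmetry

/-! ### `∫ ‖D(∇W)[e_r]‖² ≤ ∫ (ΔW)²` and Lemma 2.1 in radial-gradient form -/

section Integrated

variable {W : EuclideanSpace ℝ (Fin 3) → ℝ}

/-- The radial unit vector field is measurable. [folklore] -/
theorem measurable_eR' : Measurable (eR : EuclideanSpace ℝ (Fin 3) → EuclideanSpace ℝ (Fin 3)) := by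
  have h1 : Measurable fun x : EuclideanSpace ℝ (Fin 3) => (cylRadius x)⁻¹ :=
    continuous_cylRadius.measurable.inv
  have h2 : Continuous fun x : EuclideanSpace ℝ (Fin 3) => (toLp 2 ![x 0, x 1, 0] : EuclideanSpace ℝ (Fin 3)) := by
    fun_prop
  exact h1.smul h2.measurable

/-- **`∫ ‖D(∇W)[e_r]‖² ≤ ∫ (ΔW)²`** for `W ∈ C³` with `∂ᵢW, ∂ⱼ∂ᵢW, ∂ⱼ∂ⱼ∂ᵢW ∈ L²`. [folklore] -/
theorem integral_norm_fderiv_gradient_eR_sq_le (hW : ContDiff ℝ 3 W)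
    (h1 : ∀ i : Fin 3, MemLp (fun x => fderiv ℝ W x (EuclideanSpace.single i 1)) 2 volume)
    (h2 : ∀ i j : Fin 3, MemLp (fun x => fderiv ℝ (fun y => fderiv ℝ W y (EuclideanSpace.single i 1)) x
      (EuclideanSpace.single j 1)) 2 volume)
    (h3 : ∀ i j : Fin 3, MemLp (fun x => fderiv ℝ (fun y => fderiv ℝ (fun z => fderiv ℝ W z
      (EuclideanSpace.single i 1)) y (EuclideanSpace.single j 1)) x (EuclideanSpace.single j 1))
      2 volume) :
    Integrable (fun x => ‖fderiv ℝ (gradient W) x (eR x)‖ ^ 2) volume ∧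
    ∫ x, ‖fderiv ℝ (gradient W) x (eR x)‖ ^ 2 ≤ ∫ x, ((Δ W) x) ^ 2 := by
  have hW2 : ContDiff ℝ 2 W := hW.of_le (by norm_num)
  have hG1 : ContDiff ℝ 1 (gradient W) := contDiff_gradient_of_succ (n := 1) (by exact_mod_cast hW2)
  -- the majorant
  have hIsum : Integrable (fun x => ∑ i, ∑ j, (fderiv ℝ (fun y => fderiv ℝ W y
      (EuclideanSpace.single i 1)) x (EuclideanSpace.single j 1)) ^ 2) volume :=
    integrable_finsetSum _ fun i _ => integrable_finsetSum _ fun j _ => (h2 i j).integrable_sq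
  -- measurability of the left side
  have hmeas : AEStronglyMeasurable (fun x => ‖fderiv ℝ (gradient W) x (eR x)‖ ^ 2) volume := by
    have hc : Continuous (fderiv ℝ (gradient W)) := hG1.continuous_fderiv one_ne_zero
    have happly : Measurable fun x => fderiv ℝ (gradient W) x (eR x) := by
      have hb : Continuous fun q : (EuclideanSpace ℝ (Fin 3) →L[ℝ] EuclideanSpace ℝ (Fin 3)) ×
          EuclideanSpace ℝ (Fin 3) => q.1 q.2 :=
        (isBoundedBilinearMap_apply (𝕜 := ℝ) (E := EuclideanSpace ℝ (Fin 3))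
          (F := EuclideanSpace ℝ (Fin 3))).continuous
      exact hb.measurable.comp (hc.measurable.prodMk measurable_eR')
    exact (happly.norm.pow_const 2).aestronglyMeasurable
  have hle : ∀ x, ‖fderiv ℝ (gradient W) x (eR x)‖ ^ 2 ≤ ∑ i, ∑ j, (fderiv ℝ (fun y => fderiv ℝ W y
      (EuclideanSpace.single i 1)) x (EuclideanSpace.single j 1)) ^ 2 := fun x =>
    norm_fderiv_gradient_eR_sq_le hW2 x
  have hI : Integrable (fun x => ‖fderiv ℝ (gradient W) x (eR x)‖ ^ 2) volume := by
    refine hIsum.mono' hmeas (Eventually.of_forall fun x => ?_)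
    rw [Real.norm_eq_abs, abs_of_nonneg (sq_nonneg _)]
    exact hle x
  refine ⟨hI, ?_⟩
  rw [← integral_sum_sq_fderiv_fderiv_eq_integral_laplacian_sq_of_memLp hW h1 h2 h3]
  exact integral_mono hI hIsum hle

variable {u : EuclideanSpace ℝ (Fin 3) → EuclideanSpace ℝ (Fin 3)}

/-- **Lemma 2.1, second estimate, radial-gradient form** (Lei–Zhang 2017, Lemma 2.1 as used in
§3: "`‖∂ᵣ∇(vʳ/r)‖ ≤ ‖∇²(vʳ/r)‖ ≤ K₀‖∂_zΩ‖`", with `K₀ = 1`):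
`∫ ‖D(∇(uʳ/r))[e_r]‖² ≤ ∫ (∂_z(ω^θ/r))²` for an axisymmetric divergence-free `u ∈ C⁶` whose
quotient `W = uʳ/r` has `∂W, ∂²W, ∂³W, q_W, q_{∂₂W} ∈ L²`. [cite: LeiZhang2017, Lemma 2.1 (second estimate)] -/
theorem IsAxisymmetric.integral_norm_fderiv_gradient_radVelQuot_eR_sq_le (hax : IsAxisymmetric u)
    (hu : ContDiff ℝ 6 u) (hdiv : VectorCalculus.IsDivFree u)
    (hq : MemLp (radDerivQuot (radVelQuot u)) 2 volume)
    (h1 : ∀ i : Fin 3, MemLp (fun x => fderiv ℝ (radVelQuot u) x (EuclideanSpace.single i 1)) 2 volume)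
    (h2 : ∀ i j : Fin 3, MemLp (fun x => fderiv ℝ (fun y => fderiv ℝ (radVelQuot u) y
      (EuclideanSpace.single i 1)) x (EuclideanSpace.single j 1)) 2 volume)
    (h3 : ∀ i j : Fin 3, MemLp (fun x => fderiv ℝ (fun y => fderiv ℝ (fun z => fderiv ℝ (radVelQuot u) z
      (EuclideanSpace.single i 1)) y (EuclideanSpace.single j 1)) x (EuclideanSpace.single j 1))
      2 volume)
    (hqH : MemLp (radDerivQuot fun y => fderiv ℝ (radVelQuot u) y (EuclideanSpace.single 2 1)) 2
      volume) :
    Integrable (fun x => ‖fderiv ℝ (gradient (radVelQuot u)) x (eR x)‖ ^ 2) volume ∧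
    ∫ x, ‖fderiv ℝ (gradient (radVelQuot u)) x (eR x)‖ ^ 2 ≤
      ∫ x, fderiv ℝ (angVortQuot u) x (EuclideanSpace.single 2 1) ^ 2 := by
  have hW3 : ContDiff ℝ 3 (radVelQuot u) := contDiff_radVelQuot (n := 3) (by exact_mod_cast hu.of_le (by norm_num))
  obtain ⟨hI, hle⟩ := integral_norm_fderiv_gradient_eR_sq_le hW3 h1 h2 h3
  refine ⟨hI, hle.trans ?_⟩
  exact hax.integral_laplacian_radVelQuot_sq_le' (hu.of_le (by norm_num)) hdiv hq h1
    (fun i => h2 i i) hqH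

end Integrated

end Literature.Analysis.FluidPDE
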